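import Literature.NumberTheory.EllipticCurves.TwoDescentLocalTwoCN
import HarnessLib

/-!
# Rank-2 observatory — evaluation and the square-free kernel formula for `χ₈`
# (the `2`-adic character `a ↦ [odd part of a ≡ ±3 (mod 8)]`), and the product rule for the
# three factors of `y² = d₁ d₂ d₃`

HONEST FRAMING: per-curve certified theorems and census instruments; no claim on BSD in rank ≥ 2.

Companion of the tree's `TwoDescentLocalTwoCN.lean` (which does the same for `χ₄`). The complete
`2`-descent frame of the observatory records the class of `x - eᵢ ∈ ℚ^×/ℚ^×²` by its sign and the
parities of its valuations at the support primes; the `2`-adic local conditions are expressed in the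
three bits `(v₂ mod 2, χ₄, χ₈)` of `x - eᵢ`. This file makes `χ₈` LINEAR in the frame's coordinates:

* `chi8_eq_listSum`: if the non-zero rational `r` has even valuation at every odd prime outside the
  list `l ∌ 2`, then `chi8 r = Σ_{q ∈ l} (v_q(r) mod 2) · chi8 q` (no sign term: `chi8 (-1) = 0`);
* evaluation `chi8_eq_zero_of_eq` / `chi8_eq_one_of_eq` of `chi8 (2^k z)` from `z mod 8`;
* `chi4_factors_sum_eq_zero`, `chi8_factors_sum_eq_zero`: on `y² = d₁ d₂ d₃` the bits of the three
  factors sum to zero (so the bits of `x - e₃` are those of `x - e₁` plus those of `x - e₂`).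

Everything is proved (clones of the `χ₄` proofs); no named facts.

## References

* J. H. Silverman, *The Arithmetic of Elliptic Curves*, 2nd ed., GTM 106 (2009), Prop. X.1.4,
  Example X.1.5. [SilvermanAEC2009]
-/

noncomputable section

open scoped Classical

set_option linter.dupNamespace false

namespace Summit.BirchSwinnertonDyer.BirchSwinnertonDyer.Rank2Observatory

open Literature.NumberTheory.EllipticCurves.TwoDescentLocal
open Literature.NumberTheory.EllipticCurves.KramerTwoDescent

/-! ### Evaluation of `chi8` -/

/-- Powers of `2` do not change `chi8`. [folklore] -/
theorem chi8_two_zpow_mul (k : ℤ) (a : ℚ) : chi8 ((2 : ℚ) ^ k * a) = chi8 a := by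
  by_cases ha : a = 0
  · rw [ha, mul_zero]
  rw [chi8, chi8, res8_two_zpow_mul k ha]

/-- `chi8` only depends on the odd part. [folklore] -/
theorem chi8_unitPart (a : ℚ) : chi8 (unitPart 2 a) = chi8 a := by
  by_cases ha : a = 0
  · simp [ha, unitPart]
  conv_rhs => rw [← zpow_mul_unitPart 2 a, show ((2 : ℕ) : ℚ) = 2 from rfl]
  rw [chi8_two_zpow_mul]

/-- `chi8 (a²) = 0`. [folklore] -/
theorem chi8_sq (a : ℚ) : chi8 (a ^ 2) = 0 := by rw [sq, chi8_mul_self]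

/-- `chi8 1 = 0`. [folklore] -/
theorem chi8_one : chi8 1 = 0 := by
  have h := chi8_mul_self 1
  rwa [mul_one] at h

/-- `chi8` of an odd integer is read off its class mod `8`. [folklore] -/
theorem chi8_intCast {z : ℤ} (hz : ¬ (2 : ℤ) ∣ z) : chi8 (z : ℚ) = chi8Of (z : ZMod (2 ^ 3)) := by
  rw [chi8, res8_intCast hz]

/-- `chi8 (-1) = 0` (`-1 ≡ 7 (mod 8)`). [folklore] -/
theorem chi8_neg_one : chi8 (-1) = 0 := by
  rw [show (-1 : ℚ) = ((-1 : ℤ) : ℚ) by norm_num, chi8_intCast (by decide)]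
  decide

/-- Evaluation: `chi8 (2^k z) = 0` for an integer `z ≡ ±1 (mod 8)`. [folklore] -/
theorem chi8_eq_zero_of_eq {r : ℚ} (k : ℕ) (z : ℤ) (h : r = (2 : ℚ) ^ k * z)
    (hz : z % 8 = 1 ∨ z % 8 = 7) : chi8 r = 0 := by
  have hodd : ¬ (2 : ℤ) ∣ z := by omega
  rw [h, ← zpow_natCast, chi8_two_zpow_mul, chi8_intCast hodd, chi8Of]
  have hcast : (z : ZMod (2 ^ 3)) = ((z % 8 : ℤ) : ZMod (2 ^ 3)) := by
    rw [show (2 : ℕ) ^ 3 = 8 from rfl]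
    exact (ZMod.intCast_mod z 8).symm
  rw [hcast]
  rcases hz with h8 | h8 <;> rw [h8] <;> decide

/-- Evaluation: `chi8 (2^k z) = 1` for an integer `z ≡ ±3 (mod 8)`. [folklore] -/
theorem chi8_eq_one_of_eq {r : ℚ} (k : ℕ) (z : ℤ) (h : r = (2 : ℚ) ^ k * z)
    (hz : z % 8 = 3 ∨ z % 8 = 5) : chi8 r = 1 := by
  have hodd : ¬ (2 : ℤ) ∣ z := by omega
  rw [h, ← zpow_natCast, chi8_two_zpow_mul, chi8_intCast hodd, chi8Of]
  have hcast : (z : ZMod (2 ^ 3)) = ((z % 8 : ℤ) : ZMod (2 ^ 3)) := by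
    rw [show (2 : ℕ) ^ 3 = 8 from rfl]
    exact (ZMod.intCast_mod z 8).symm
  rw [hcast]
  rcases hz with h8 | h8 <;> rw [h8] <;> decide

/-! ### The square-free kernel formula for `chi8` -/

/-- `chi8` of a product of non-zero naturals is the sum. [folklore] -/
theorem chi8_prod_natCast (S : Finset ℕ) (hS : ∀ q ∈ S, q ≠ 0) :
    chi8 (∏ q ∈ S, (q : ℚ)) = ∑ q ∈ S, chi8 (q : ℚ) := by
  classical
  induction S using Finset.induction_on with
  | empty => simp [chi8_one]
  | insert a S ha ih =>
    have hS' : ∀ q ∈ S, q ≠ 0 := fun q hq => hS q (Finset.mem_insert_of_mem hq)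
    have ha0 : (a : ℚ) ≠ 0 := Nat.cast_ne_zero.mpr (hS a (Finset.mem_insert_self a S))
    have hprod : (∏ q ∈ S, (q : ℚ)) ≠ 0 :=
      Finset.prod_ne_zero_iff.mpr fun q hq => Nat.cast_ne_zero.mpr (hS' q hq)
    rw [Finset.prod_insert ha, Finset.sum_insert ha, chi8_mul ha0 hprod, ih hS']

/-- Positive case of the square-free kernel formula for `chi8`. [folklore] -/
theorem chi8_eq_sum_of_pos {w : ℚ} (hw : 0 < w) (T : Finset ℕ)
    (hT : ∀ q ∈ T, q.Prime) (heven : ∀ q : ℕ, q.Prime → q ∉ T → Even (padicValRat q w)) :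
    chi8 w = ∑ q ∈ T, parityBit q w * chi8 (q : ℚ) := by
  classical
  set S := T.filter fun q => ¬ Even (padicValRat q w) with hSdef
  have hS : ∀ q ∈ S, q.Prime := fun q hq => hT q (Finset.mem_filter.mp hq).1
  have hkey : ∀ q : ℕ, q.Prime → (Even (padicValRat q w) ↔ q ∉ S) := by
    intro q hq
    rw [hSdef, Finset.mem_filter, not_and, not_not]
    constructor
    · exact fun he _ => he
    · intro himp
      by_cases hqT : q ∈ T
      · exact himp hqT
      · exact heven q hq hqT
  obtain ⟨t, ht⟩ := exists_eq_prod_mul_sq hS hw hkey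
  have hprod : (∏ q ∈ S, (q : ℚ)) ≠ 0 :=
    Finset.prod_ne_zero_iff.mpr fun q hq => Nat.cast_ne_zero.mpr (hS q hq).ne_zero
  have ht0 : t ≠ 0 := by
    rintro rfl
    rw [zero_pow two_ne_zero, mul_zero] at ht
    exact hw.ne' ht
  rw [ht, chi8_mul hprod (pow_ne_zero 2 ht0), chi8_sq, add_zero,
    chi8_prod_natCast S fun q hq => (hS q hq).ne_zero, ← ht]
  have hSsub : S ⊆ T := Finset.filter_subset _ _
  rw [← Finset.sum_subset hSsub (f := fun q => parityBit q w * chi8 (q : ℚ)) ?_]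
  · refine Finset.sum_congr rfl fun q hq => ?_
    have hodd : ¬ Even (padicValRat q w) := (Finset.mem_filter.mp hq).2
    rw [parityBit_eq_one_of_odd (Int.not_even_iff_odd.mp hodd), one_mul]
  · intro q hqT hqS
    have heven' : Even (padicValRat q w) := (hkey q (hT q hqT)).mpr hqS
    rw [parityBit_eq_zero_of_even heven', zero_mul]

/-- **The square-free kernel formula for `χ₈`**: if the non-zero rational `r` has even valuation at
every ODD prime outside the finite set of primes `T ∌ 2`, then `chi8 r = Σ_{q ∈ T} (v_q(r) mod 2) · chi8 q`
(the sign does not enter: `chi8 (-1) = 0`). [folklore] -/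
theorem chi8_eq_sum {r : ℚ} (hr : r ≠ 0) (T : Finset ℕ) (hT : ∀ q ∈ T, q.Prime)
    (h2T : 2 ∉ T) (heven : ∀ q : ℕ, q.Prime → q ∉ T → q ≠ 2 → Even (padicValRat q r)) :
    chi8 r = ∑ q ∈ T, parityBit q r * chi8 (q : ℚ) := by
  haveI : Fact (Nat.Prime 2) := ⟨Nat.prime_two⟩
  set u := unitPart 2 r with hu
  have hu0 : u ≠ 0 := unitPart_ne_zero 2 hr
  have hur : chi8 r = chi8 u := (chi8_unitPart r).symm
  have hpar : ∀ q ∈ T, parityBit q r = parityBit q u := by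
    intro q hq
    haveI : Fact q.Prime := ⟨hT q hq⟩
    have hq2 : q ≠ 2 := fun h => h2T (h ▸ hq)
    rw [parityBit, parityBit, hu, padicValRat_unitPart_of_ne hq2]
  have hevenu : ∀ q : ℕ, q.Prime → q ∉ T → Even (padicValRat q u) := by
    intro q hq hqT
    haveI : Fact q.Prime := ⟨hq⟩
    by_cases hq2 : q = 2
    · rw [hq2, hu, padicValRat_unitPart 2 hr]; exact ⟨0, rfl⟩
    · rw [hu, padicValRat_unitPart_of_ne hq2]; exact heven q hq hqT hq2
  rw [hur, Finset.sum_congr rfl fun q hq => by rw [hpar q hq]]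
  rcases lt_or_gt_of_ne hu0 with hneg | hpos
  · have hw : 0 < -u := neg_pos.mpr hneg
    have key := chi8_eq_sum_of_pos hw T hT fun q hq hqT => by
      rw [padicValRat.neg]; exact hevenu q hq hqT
    rw [show u = -1 * (-u) by ring, chi8_mul (by norm_num) hw.ne', key, chi8_neg_one, zero_add]
    refine Finset.sum_congr rfl fun q _ => ?_
    rw [parityBit, parityBit, show -1 * -u = u by ring, padicValRat.neg]
  · exact chi8_eq_sum_of_pos hpos T hT hevenu

/-- List form of `chi8_eq_sum` (the shape used by the per-curve files). [folklore] -/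
theorem chi8_eq_listSum {r : ℚ} (hr : r ≠ 0) (l : List ℕ) (hl : l.Nodup)
    (hprime : ∀ q ∈ l, q.Prime) (h2l : 2 ∉ l)
    (heven : ∀ q : ℕ, q.Prime → q ∉ l → q ≠ 2 → Even (padicValRat q r)) :
    chi8 r = (l.map fun q => parityBit q r * chi8 (q : ℚ)).sum := by
  have key := chi8_eq_sum hr l.toFinset (fun q hq => hprime q (List.mem_toFinset.mp hq))
    (fun h => h2l (List.mem_toFinset.mp h))
    (fun q hq hql hq2 => heven q hq (fun h => hql (List.mem_toFinset.mpr h)) hq2)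
  rw [key, List.sum_toFinset _ hl]

/-! ### The three factors of `y² = d₁ d₂ d₃` -/

/-- From `y² = d₁ d₂ d₃`: `chi4 d₁ + chi4 d₂ + chi4 d₃ = 0`. [folklore] -/
theorem chi4_factors_sum_eq_zero {d₁ d₂ d₃ y : ℚ} (h : y ^ 2 = d₁ * d₂ * d₃) (h₁ : d₁ ≠ 0)
    (h₂ : d₂ ≠ 0) (h₃ : d₃ ≠ 0) : chi4 d₁ + chi4 d₂ + chi4 d₃ = 0 := by
  rw [← chi4_mul h₁ h₂, ← chi4_mul (mul_ne_zero h₁ h₂) h₃, ← h, chi4_sq]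

/-- From `y² = d₁ d₂ d₃`: `chi8 d₁ + chi8 d₂ + chi8 d₃ = 0`. [folklore] -/
theorem chi8_factors_sum_eq_zero {d₁ d₂ d₃ y : ℚ} (h : y ^ 2 = d₁ * d₂ * d₃) (h₁ : d₁ ≠ 0)
    (h₂ : d₂ ≠ 0) (h₃ : d₃ ≠ 0) : chi8 d₁ + chi8 d₂ + chi8 d₃ = 0 := by
  rw [← chi8_mul h₁ h₂, ← chi8_mul (mul_ne_zero h₁ h₂) h₃, ← h, chi8_sq]

/-- From `y² = d₁ d₂ d₃`: the `2`-adic parity bits of the three factors sum to zero. [folklore] -/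
theorem parityBit_factors_sum_eq_zero {p : ℕ} [Fact p.Prime] {d₁ d₂ d₃ y : ℚ}
    (h : y ^ 2 = d₁ * d₂ * d₃) (h₁ : d₁ ≠ 0) (h₂ : d₂ ≠ 0) (h₃ : d₃ ≠ 0) :
    parityBit p d₁ + parityBit p d₂ + parityBit p d₃ = 0 := by
  have hev := even_sum_padicValRat_of_sq (p := p) h h₁ h₂ h₃
  unfold parityBit
  rw [← Int.cast_add, ← Int.cast_add, ZMod.intCast_zmod_eq_zero_iff_dvd]
  exact even_iff_two_dvd.mp hev

end Summit.BirchSwinnertonDyer.BirchSwinnertonDyer.Rank2Observatory
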